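import Mathlib
import Summits.MatrixMultiplication.MatrixMultiplication.Theorems.SubgroupIdentityDesigns.Negative.RegularSL

/-!
# Central products `(scalars) · (unimodular)` of order `p² - 1` act regularly (all `p`)

Route `LevelGradedCohnUmans`, crux `SubgroupIdentityDesigns`, the `(m,k) = (2,1)` cell, `p`-free
case.  `RegularSL` supplies the cross-member engine with UNIMODULAR regular subgroups.  The
remaining exceptional near-field groups are not unimodular: they are central products `C · K₁`
of a group of scalars `C ≅ μ_M` with a unimodular group `K₁` of exponent dividing `N`,
`gcd(M, N) = 1`, `p ∤ N` — `2T ∘ μ₅` in `GL₂(𝔽₁₁)` (`M = 5`, `N = 24`), `2O ∘ μ₁₁` in `GL₂(𝔽₂₃)`,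
`2I ∘ μ₇` in `GL₂(𝔽₂₉)`, `2I ∘ μ₂₉` in `GL₂(𝔽₅₉)`.
* `free_of_central_unimodular`: if every `k ∈ K` is `s • g` with `s^M = 1`, `det g = 1`,
  `g^N = 1`, then `K` acts freely on `𝔽_p² ∖ 0` (a fixed vector of `k` is an eigenvector of `g`
  with eigenvalue `s⁻¹`, so `g^M` is a unimodular `p'`-element fixing it, `g^M = 1 = g^N`, `g = 1`,
  `s = 1`);
* with `|K| = p² - 1` it is transitive (`transitive_of_free_of_card`), whence the six placements
  `no_levelOne_design_of_central_unimodular₂₁/₃₁/₃₂/₁₂/₁₃/₂₃`.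
All `p`; no TPP, no volume hypothesis.  VALUE = THEOREM, NOT summit progress; the crux item
stmt-MatrixMultiplication-14079 is untouched and remains open.
-/

set_option linter.dupNamespace false

noncomputable section

open scoped BigOperators Classical

open Summit.MatrixMultiplication.MatrixMultiplication.Theorems.LieRankDesigns.Negative (GLm Mat)

namespace Summit.MatrixMultiplication.MatrixMultiplication.Theorems.SubgroupIdentityDesigns.Negative

section RegularCentral

variable {p : ℕ} [hp : Fact p.Prime]

/-- **Central products of scalars with a unimodular group of coprime exponent act freely.** -/
theorem free_of_central_unimodular {K : Subgroup (GLm p 2)} {M N : ℕ} (hN : ¬ p ∣ N)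
    (hMN : Nat.Coprime M N)
    (hK : ∀ k ∈ K, ∃ s : ZMod p, ∃ g : GLm p 2, s ^ M = 1 ∧ Matrix.det (g : Mat p 2) = 1 ∧
      g ^ N = 1 ∧ ((k : GLm p 2) : Mat p 2) = s • (g : Mat p 2)) :
    ∀ a : Fin 2 → ZMod p, a ≠ 0 → ∀ k ∈ K, ∀ k' ∈ K,
      ((k : GLm p 2) : Mat p 2).mulVec a = ((k' : GLm p 2) : Mat p 2).mulVec a → k = k' := by
  refine free_of_fixers fun a ha k hk hka => ?_
  obtain ⟨s, g, hsM, hgdet, hgN, hks⟩ := hK k hk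
  -- `s ≠ 0` since `k` is invertible
  have hs0 : s ≠ 0 := by
    intro hs
    apply Matrix.GeneralLinearGroup.det_ne_zero k
    rw [hks, hs, zero_smul, Matrix.det_zero]
  -- `g a = s⁻¹ • a`, so `g ^ m` scales `a` by `s⁻¹ ^ m`
  have hga : (g : Mat p 2).mulVec a = s⁻¹ • a := by
    have h := hka
    rw [hks, Matrix.smul_mulVec] at h
    calc (g : Mat p 2).mulVec a = s⁻¹ • (s • (g : Mat p 2).mulVec a) := by
          rw [smul_smul, inv_mul_cancel₀ hs0, one_smul]
      _ = s⁻¹ • a := by rw [h]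
  have hgpow : ∀ m : ℕ, ((g ^ m : GLm p 2) : Mat p 2).mulVec a = (s⁻¹) ^ m • a := by
    intro m
    induction m with
    | zero => simp
    | succ m ih =>
      rw [pow_succ, Units.val_mul, ← Matrix.mulVec_mulVec, hga, Matrix.mulVec_smul, ih, smul_smul,
        ← pow_succ']
  -- `g ^ M` is a unimodular `p'`-element fixing `a`
  have hgMa : ((g ^ M : GLm p 2) : Mat p 2).mulVec a = a := by
    rw [hgpow M, inv_pow, hsM, inv_one, one_smul]
  have hgMdet : Matrix.det ((g ^ M : GLm p 2) : Mat p 2) = 1 := by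
    rw [Units.val_pow_eq_pow_val, Matrix.det_pow, hgdet, one_pow]
  have hgMN : (g ^ M) ^ N = 1 := by rw [← pow_mul, mul_comm, pow_mul, hgN, one_pow]
  have hgM : g ^ M = 1 := eq_one_of_det_one_of_fix (g ^ M) hgMdet hN hgMN ha hgMa
  -- coprime exponents force `g = 1`
  have hg1 : g = 1 := by
    have h1 : orderOf g ∣ M := orderOf_dvd_of_pow_eq_one hgM
    have h2 : orderOf g ∣ N := orderOf_dvd_of_pow_eq_one hgN
    have h3 : orderOf g ∣ Nat.gcd M N := Nat.dvd_gcd h1 h2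
    rw [Nat.Coprime.gcd_eq_one hMN, Nat.dvd_one] at h3
    exact orderOf_eq_one_iff.mp h3
  -- then `k = s • 1` fixes `a ≠ 0`, so `s = 1`
  rw [hg1, Units.val_one] at hks
  have hsa : s • a = a := by
    have h := hka
    rwa [hks, Matrix.smul_mulVec, Matrix.one_mulVec] at h
  have hs1 : s = 1 := by
    by_contra hs1
    apply ha
    have h2 : (s - 1) • a = 0 := by rw [sub_smul, one_smul, hsa, sub_self]
    rcases smul_eq_zero.mp h2 with h | h
    · exact absurd (sub_eq_zero.mp h) hs1
    · exact h
  rw [hs1, one_smul] at hks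
  exact Units.val_eq_one.mp hks

/-! ### The six placements -/

/-- **A central product `μ_M · K₁` (`K₁` unimodular of exponent `∣ N`, `gcd(M,N) = 1`, `p ∤ N`)
of order `p² - 1` in `H₂`, an element of `H₁` outside it ⇒ no level-one identity design**
(all `p`; no TPP). -/
theorem no_levelOne_design_of_central_unimodular₂₁ {H₁ H₂ H₃ : Subgroup (GLm p 2)}
    (K : Subgroup (GLm p 2)) {M N : ℕ} (hN : ¬ p ∣ N) (hMN : Nat.Coprime M N)
    (hK : ∀ k ∈ K, ∃ s : ZMod p, ∃ g : GLm p 2, s ^ M = 1 ∧ Matrix.det (g : Mat p 2) = 1 ∧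
      g ^ N = 1 ∧ ((k : GLm p 2) : Mat p 2) = s • (g : Mat p 2))
    (hKcard : Nat.card K = p ^ 2 - 1)
    (hKH : K ≤ H₂) (k₀ : GLm p 2) (hk₀ : k₀ ∈ H₁) (hk₀K : k₀ ∉ K) :
    ¬ ∃ c : Mat p 2 → ℂ, (∀ M, 1 < M.rank → c M = 0) ∧
      (∑ M, c M * ZMod.stdAddChar (Matrix.trace (M * ((1 : GLm p 2) : Mat p 2)))) = 1 ∧
      ∀ a ∈ H₁, ∀ b ∈ H₂, ∀ g ∈ H₃, a * b * g ≠ 1 →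
        (∑ M, c M *
          ZMod.stdAddChar (Matrix.trace (M * ((a * b * g : GLm p 2) : Mat p 2)))) = 0 :=
  no_levelOne_design_of_transitive₂₁ K hKH k₀ hk₀ hk₀K (free_of_central_unimodular hN hMN hK)
    (transitive_of_free_of_card (free_of_central_unimodular hN hMN hK) hKcard)

/-- **A central product `μ_M · K₁` (`K₁` unimodular of exponent `∣ N`, `gcd(M,N) = 1`, `p ∤ N`)
of order `p² - 1` in `H₃`, an element of `H₁` outside it ⇒ no level-one identity design**
(all `p`; no TPP). -/
theorem no_levelOne_design_of_central_unimodular₃₁ {H₁ H₂ H₃ : Subgroup (GLm p 2)}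
    (K : Subgroup (GLm p 2)) {M N : ℕ} (hN : ¬ p ∣ N) (hMN : Nat.Coprime M N)
    (hK : ∀ k ∈ K, ∃ s : ZMod p, ∃ g : GLm p 2, s ^ M = 1 ∧ Matrix.det (g : Mat p 2) = 1 ∧
      g ^ N = 1 ∧ ((k : GLm p 2) : Mat p 2) = s • (g : Mat p 2))
    (hKcard : Nat.card K = p ^ 2 - 1)
    (hKH : K ≤ H₃) (k₀ : GLm p 2) (hk₀ : k₀ ∈ H₁) (hk₀K : k₀ ∉ K) :
    ¬ ∃ c : Mat p 2 → ℂ, (∀ M, 1 < M.rank → c M = 0) ∧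
      (∑ M, c M * ZMod.stdAddChar (Matrix.trace (M * ((1 : GLm p 2) : Mat p 2)))) = 1 ∧
      ∀ a ∈ H₁, ∀ b ∈ H₂, ∀ g ∈ H₃, a * b * g ≠ 1 →
        (∑ M, c M *
          ZMod.stdAddChar (Matrix.trace (M * ((a * b * g : GLm p 2) : Mat p 2)))) = 0 :=
  no_levelOne_design_of_transitive₃₁ K hKH k₀ hk₀ hk₀K (free_of_central_unimodular hN hMN hK)
    (transitive_of_free_of_card (free_of_central_unimodular hN hMN hK) hKcard)

/-- **A central product `μ_M · K₁` (`K₁` unimodular of exponent `∣ N`, `gcd(M,N) = 1`, `p ∤ N`)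
of order `p² - 1` in `H₃`, an element of `H₂` outside it ⇒ no level-one identity design**
(all `p`; no TPP). -/
theorem no_levelOne_design_of_central_unimodular₃₂ {H₁ H₂ H₃ : Subgroup (GLm p 2)}
    (K : Subgroup (GLm p 2)) {M N : ℕ} (hN : ¬ p ∣ N) (hMN : Nat.Coprime M N)
    (hK : ∀ k ∈ K, ∃ s : ZMod p, ∃ g : GLm p 2, s ^ M = 1 ∧ Matrix.det (g : Mat p 2) = 1 ∧
      g ^ N = 1 ∧ ((k : GLm p 2) : Mat p 2) = s • (g : Mat p 2))
    (hKcard : Nat.card K = p ^ 2 - 1)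
    (hKH : K ≤ H₃) (k₀ : GLm p 2) (hk₀ : k₀ ∈ H₂) (hk₀K : k₀ ∉ K) :
    ¬ ∃ c : Mat p 2 → ℂ, (∀ M, 1 < M.rank → c M = 0) ∧
      (∑ M, c M * ZMod.stdAddChar (Matrix.trace (M * ((1 : GLm p 2) : Mat p 2)))) = 1 ∧
      ∀ a ∈ H₁, ∀ b ∈ H₂, ∀ g ∈ H₃, a * b * g ≠ 1 →
        (∑ M, c M *
          ZMod.stdAddChar (Matrix.trace (M * ((a * b * g : GLm p 2) : Mat p 2)))) = 0 :=
  no_levelOne_design_of_transitive₃₂ K hKH k₀ hk₀ hk₀K (free_of_central_unimodular hN hMN hK)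
    (transitive_of_free_of_card (free_of_central_unimodular hN hMN hK) hKcard)

/-- **A central product `μ_M · K₁` (`K₁` unimodular of exponent `∣ N`, `gcd(M,N) = 1`, `p ∤ N`)
of order `p² - 1` in `H₁`, an element of `H₂` outside it ⇒ no level-one identity design**
(all `p`; no TPP). -/
theorem no_levelOne_design_of_central_unimodular₁₂ {H₁ H₂ H₃ : Subgroup (GLm p 2)}
    (K : Subgroup (GLm p 2)) {M N : ℕ} (hN : ¬ p ∣ N) (hMN : Nat.Coprime M N)
    (hK : ∀ k ∈ K, ∃ s : ZMod p, ∃ g : GLm p 2, s ^ M = 1 ∧ Matrix.det (g : Mat p 2) = 1 ∧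
      g ^ N = 1 ∧ ((k : GLm p 2) : Mat p 2) = s • (g : Mat p 2))
    (hKcard : Nat.card K = p ^ 2 - 1)
    (hKH : K ≤ H₁) (k₀ : GLm p 2) (hk₀ : k₀ ∈ H₂) (hk₀K : k₀ ∉ K) :
    ¬ ∃ c : Mat p 2 → ℂ, (∀ M, 1 < M.rank → c M = 0) ∧
      (∑ M, c M * ZMod.stdAddChar (Matrix.trace (M * ((1 : GLm p 2) : Mat p 2)))) = 1 ∧
      ∀ a ∈ H₁, ∀ b ∈ H₂, ∀ g ∈ H₃, a * b * g ≠ 1 →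
        (∑ M, c M *
          ZMod.stdAddChar (Matrix.trace (M * ((a * b * g : GLm p 2) : Mat p 2)))) = 0 :=
  no_levelOne_design_of_transitive₁₂ K hKH k₀ hk₀ hk₀K (free_of_central_unimodular hN hMN hK)
    (transitive_of_free_of_card (free_of_central_unimodular hN hMN hK) hKcard)

/-- **A central product `μ_M · K₁` (`K₁` unimodular of exponent `∣ N`, `gcd(M,N) = 1`, `p ∤ N`)
of order `p² - 1` in `H₁`, an element of `H₃` outside it ⇒ no level-one identity design**
(all `p`; no TPP). -/
theorem no_levelOne_design_of_central_unimodular₁₃ {H₁ H₂ H₃ : Subgroup (GLm p 2)}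
    (K : Subgroup (GLm p 2)) {M N : ℕ} (hN : ¬ p ∣ N) (hMN : Nat.Coprime M N)
    (hK : ∀ k ∈ K, ∃ s : ZMod p, ∃ g : GLm p 2, s ^ M = 1 ∧ Matrix.det (g : Mat p 2) = 1 ∧
      g ^ N = 1 ∧ ((k : GLm p 2) : Mat p 2) = s • (g : Mat p 2))
    (hKcard : Nat.card K = p ^ 2 - 1)
    (hKH : K ≤ H₁) (k₀ : GLm p 2) (hk₀ : k₀ ∈ H₃) (hk₀K : k₀ ∉ K) :
    ¬ ∃ c : Mat p 2 → ℂ, (∀ M, 1 < M.rank → c M = 0) ∧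
      (∑ M, c M * ZMod.stdAddChar (Matrix.trace (M * ((1 : GLm p 2) : Mat p 2)))) = 1 ∧
      ∀ a ∈ H₁, ∀ b ∈ H₂, ∀ g ∈ H₃, a * b * g ≠ 1 →
        (∑ M, c M *
          ZMod.stdAddChar (Matrix.trace (M * ((a * b * g : GLm p 2) : Mat p 2)))) = 0 :=
  no_levelOne_design_of_transitive₁₃ K hKH k₀ hk₀ hk₀K (free_of_central_unimodular hN hMN hK)
    (transitive_of_free_of_card (free_of_central_unimodular hN hMN hK) hKcard)

/-- **A central product `μ_M · K₁` (`K₁` unimodular of exponent `∣ N`, `gcd(M,N) = 1`, `p ∤ N`)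
of order `p² - 1` in `H₂`, an element of `H₃` outside it ⇒ no level-one identity design**
(all `p`; no TPP). -/
theorem no_levelOne_design_of_central_unimodular₂₃ {H₁ H₂ H₃ : Subgroup (GLm p 2)}
    (K : Subgroup (GLm p 2)) {M N : ℕ} (hN : ¬ p ∣ N) (hMN : Nat.Coprime M N)
    (hK : ∀ k ∈ K, ∃ s : ZMod p, ∃ g : GLm p 2, s ^ M = 1 ∧ Matrix.det (g : Mat p 2) = 1 ∧
      g ^ N = 1 ∧ ((k : GLm p 2) : Mat p 2) = s • (g : Mat p 2))
    (hKcard : Nat.card K = p ^ 2 - 1)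
    (hKH : K ≤ H₂) (k₀ : GLm p 2) (hk₀ : k₀ ∈ H₃) (hk₀K : k₀ ∉ K) :
    ¬ ∃ c : Mat p 2 → ℂ, (∀ M, 1 < M.rank → c M = 0) ∧
      (∑ M, c M * ZMod.stdAddChar (Matrix.trace (M * ((1 : GLm p 2) : Mat p 2)))) = 1 ∧
      ∀ a ∈ H₁, ∀ b ∈ H₂, ∀ g ∈ H₃, a * b * g ≠ 1 →
        (∑ M, c M *
          ZMod.stdAddChar (Matrix.trace (M * ((a * b * g : GLm p 2) : Mat p 2)))) = 0 :=
  no_levelOne_design_of_transitive₂₃ K hKH k₀ hk₀ hk₀K (free_of_central_unimodular hN hMN hK)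
    (transitive_of_free_of_card (free_of_central_unimodular hN hMN hK) hKcard)

end RegularCentral

end Summit.MatrixMultiplication.MatrixMultiplication.Theorems.SubgroupIdentityDesigns.Negative

end
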